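import Summits.NavierStokesRegularity.FluidComputer.PalasekTowerLundgrenChildEntropyClock
import Summits.NavierStokesRegularity.FluidComputer.PalasekTowerChildCoreLedgerStokes

/-!
# REGISTER v2.3″ (continued): THE CORE FACE OF THE ENTROPY CLOCK — the rim circulation of a Lundgren-carried
# child with ANY positive log-tame cross-section is `≥ Γ(1 − e^{−λA_k r²/4}) − (2ΓH₀)^{1/2} e^{−λA_k s/2}`

Cell `ns-blowup`, seat `ns-blowup-ecbridge-8` (g9); evidence toward crux 19250 `HeredityFromTwo`, floor
`stub_core_floors` / `CoreFloorAt k`, MODEL lane «child core = cross-section of Lundgren's stretched flow in the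
host strain `c = λA_k` at `ν = 1`, ANY positive log-tame profile» — the setting and hypotheses of
`PalasekTowerLundgrenChildEntropyClock` (the cross-section is a classical unforced planar Navier–Stokes run
`ṽ = K₂ ∗ ω̃` on a convex planar-time set `S'`, uniformly rapidly decaying, POSITIVE and LOG-TAME, `0 ∈ S'`,
circulation `Γ = ∫ ω̃(0)`, relative entropy `H₀` at the hand-over; a smooth passive axial scalar `W̃`; the
window `S` is mapped into `S'` by Lundgren's clock `τ(s) = (e^{cs} − 1)/c`).

The Stokes form of the core clause (`PalasekTowerChildCoreLedgerStokes`: the ledger circle wound four times;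
`∮ = ∫_{disc}(curl u)₂`; for the Burgers child `∮ = Γ(1 − e^{−cr²/4})`) and the 3D `L¹` clock
(`…_anyProfile_childVorticity_L1_burgers_clock`: `∫|ω_z(s) − ω_B| dy ≤ (2ΓH₀)^{1/2}e^{−cs/2}` on every
cross-section) give:

* `palasekTowerBreakdown_anyProfile_child_rimCirculation_ge` — for every strain time `s ≥ 0` of the window,
  every height `z₀` and radius `r > 0`:
  **`∮_{circle(z₀e_z, r)} u(s)·dℓ ≥ Γ(1 − e^{−cr²/4}) − (2ΓH₀)^{1/2} e^{−cs/2}`**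
  (`∫_{disc}ω_z ≥ ∫_{disc}ω_B − ∫_{ℝ²}|ω_z − ω_B|`, the plane integral transported to coordinates by
  `Literature.Analysis.Calculus.integral_euclidean_eq_integral_prod`);
* `palasekTowerBreakdown_anyProfile_child_coreClause` — once
  `c₁N_{k+1}^{β−2}/4 ≤ Γ(1 − e^{−λA_k/(4N_{k+1}²)}) − (2ΓH₀)^{1/2}e^{−λA_k s/2}`, the child's velocity field at
  strain time `s` meets the level-`(k+1)` core clause on the cross-section `{x₂ = z₀}`, `|z₀| ≤ radius`;
* `palasekTowerBreakdown_anyProfile_child_coreClause_wide` — THE CORE CLOCK AS A NUMBER (wide rates, `λ = 1`,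
  every `k ≥ 2`): **`H₀ ≤ Γ`, `Γ ≥ 0.86·c₁N_{k+1}^{β−2}` and `A_k s ≥ 8` strain times ⇒ the clause**
  (Burgers child: `C ≥ 0.77·c₁`, `…_coreClause_stokes_wide`).

REGISTER READING. On the CORE face the any-profile class inherits the Burgers child's Stokes-form threshold
`c₁ ≤ 4C(1 − e^{−x_k/4})` up to the clock defect: with `Γ = C·N_{k+1}^{β−2}` and `H₀ ≤ Γ`, after
`λA_k s ≥ 2 log(10·2^{1/2}) ≈ 5.3` strain times the defect is `≤ Γ/10` and `c₁ ≤ 4C(1 − e^{−x_k/4} − 1/10)`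
suffices — at every level, since `x_k ≥ x_2 > 1.95λ`. WHAT THIS IS NOT: not NS about registered flows; no
registered Stage; positivity/log-tameness of the cross-section are HYPOTHESES; sign-changing cross-sections
are out of scope.

## References
* [cite: GallayWayne2005, §3.4 (arXiv:math/0402449 p. 14)] · [cite: Saffman1992, §13.3 eqs. (26)–(29)]
* [cite: MajdaBertozziCUP2002, §1.6 (1.60)–(1.61)] · [cite: Palasek2026ElementaryModel, §3.1]
-/

noncomputable section

namespace Summit.NavierStokesRegularity.FluidComputer.PalasekTowerClayBridge

open Real Set MeasureTheory Function
open scoped RealInnerProductSpace ContDiff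
open Literature.Analysis.FluidPDE Literature.Analysis.FluidPDE.Lundgren Literature.Analysis.Calculus
open CoreLedgerStokes

variable {S S' : Set ℝ}
  {v : ℝ → EuclideanSpace ℝ (Fin 2) → EuclideanSpace ℝ (Fin 2)}
  {q : ℝ → EuclideanSpace ℝ (Fin 2) → ℝ} {w : ℝ → EuclideanSpace ℝ (Fin 2) → ℝ}

namespace CoreClock

/-- The vorticity slice of a classical planar solution with uniformly rapidly decaying vorticity is
integrable. [folklore] -/
theorem integrable_planarVorticity {ν : ℝ} {f : ℝ → EuclideanSpace ℝ (Fin 2) → EuclideanSpace ℝ (Fin 2)}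
    (h : IsClassicalNSSolutionOn S' ν f v q)
    (hω : HasUniformRapidDecayOn S' (fun σ η => PlanarEigenmode.vorticity (v σ) η)) {σ : ℝ} (hσ : σ ∈ S') :
    Integrable (PlanarEigenmode.vorticity (v σ)) (volume : Measure (EuclideanSpace ℝ (Fin 2))) := by
  obtain ⟨C, hC0, hC⟩ := hω.norm_le_rpow 3
  have hu2 : ContDiff ℝ 2 (v σ) := contDiff_infty.1 (h.contDiff_velocity hσ) 2
  have hD : ContDiff ℝ 1 (fderiv ℝ (v σ)) := hu2.fderiv_right (m := 1) (by norm_num)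
  have e : PlanarEigenmode.vorticity (v σ) = fun z =>
      fderiv ℝ (v σ) z (EuclideanSpace.single 0 1) 1 - fderiv ℝ (v σ) z (EuclideanSpace.single 1 1) 0 := rfl
  have hcont : Continuous (PlanarEigenmode.vorticity (v σ)) := by
    rw [e]
    exact ((contDiff_euclidean.1 (hD.clm_apply contDiff_const) 1).sub
      (contDiff_euclidean.1 (hD.clm_apply contDiff_const) 0)).continuous
  refine integrable_of_norm_le_rpow_neg hcont (C := C) (r := ((3 : ℕ) : ℝ)) ?_ fun y => hC σ hσ y
  rw [finrank_euclideanSpace_fin]; norm_num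

/-- The planar Gaussian `e^{−b‖y‖²}` (`b > 0`) is integrable on `ℝ²`. [folklore] -/
theorem integrable_exp_neg_mul_norm_sq {b : ℝ} (hb : 0 < b) :
    Integrable (fun y : EuclideanSpace ℝ (Fin 2) => exp (-(b * ‖y‖ ^ 2)))
      (volume : Measure (EuclideanSpace ℝ (Fin 2))) := by
  have h := GaussianFourier.integral_rexp_neg_mul_sq_norm (V := EuclideanSpace ℝ (Fin 2)) hb
  have e : (fun y : EuclideanSpace ℝ (Fin 2) => exp (-(b * ‖y‖ ^ 2))) = fun y => exp (-b * ‖y‖ ^ 2) := by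
    funext y; rw [neg_mul]
  rw [e]
  by_contra hni
  rw [integral_undef hni, finrank_euclideanSpace_fin] at h
  have : (0 : ℝ) < (π / b) ^ ((2 : ℕ) / 2 : ℝ) := Real.rpow_pos_of_pos (by positivity) _
  linarith

/-- The Burgers cross-section `y ↦ ω_B(ι y + z₀ e_z) = Γc/(4π) e^{−c‖y‖²/4}` is integrable (`c > 0`). [folklore] -/
theorem integrable_burgersVorticity_slice {c : ℝ} (hc : 0 < c) (Γ z₀ : ℝ) :
    Integrable (fun y : EuclideanSpace ℝ (Fin 2) => burgersVorticity c 1 Γ (embedXY y + z₀ • eZ))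
      (volume : Measure (EuclideanSpace ℝ (Fin 2))) := by
  have e : (fun y : EuclideanSpace ℝ (Fin 2) => burgersVorticity c 1 Γ (embedXY y + z₀ • eZ)) =
      fun y => c * Γ / (4 * π * 1) * exp (-(c / 4 * ‖y‖ ^ 2)) := by
    funext y
    have hn : ‖y‖ ^ 2 = y 0 ^ 2 + y 1 ^ 2 := by
      rw [EuclideanSpace.norm_sq_eq, Fin.sum_univ_two, Real.norm_eq_abs, Real.norm_eq_abs, sq_abs, sq_abs]
    have hx0 : (embedXY y + z₀ • eZ) 0 = y 0 := by simp [eZ]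
    have hx1 : (embedXY y + z₀ • eZ) 1 = y 1 := by simp [eZ]
    rw [burgersVorticity, hx0, hx1, hn]
    congr 2
    ring
  rw [e]
  exact (integrable_exp_neg_mul_norm_sq (by positivity)).const_mul _

end CoreClock

open CoreClock

/-! ### §4 Any positive log-tame child core: the rim circulation after the entropy clock -/

/-- **THE RIM CIRCULATION OF THE ANY-PROFILE CHILD IS WITHIN THE `L¹` CLOCK OF THE BURGERS VALUE** (setting
of `palasekTowerBreakdown_anyProfile_childVorticity_L1_burgers_clock`: the Lundgren child at constant rate
`c = λA_k`, `ν = 1`, carrying a positive log-tame planar run `ṽ = K₂ ∗ ω̃` and a smooth passive axial scalar;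
`Γ = ∫ ω̃(0)`, `H₀` the relative entropy at the hand-over). For every strain time `s ≥ 0` of the window `S`,
every height `z₀` and every radius `r > 0`:
**`∮_{circle(z₀e_z, r)} u(s)·dℓ ≥ Γ(1 − e^{−cr²/4}) − (2ΓH₀)^{1/2} e^{−cs/2}`**
— Stokes in set form for the child and for the Burgers vortex (§2), `∮ u_B·dℓ = Γ(1 − e^{−cr²/4})` (§3), and
`∫_{disc} |ω_z(s) − ω_B| ≤ ∫_{ℝ²} |ω_z(s) − ω_B| ≤ (2ΓH₀)^{1/2}e^{−cs/2}` (the 3D `L¹` clock).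
[cite: GallayWayne2005, §3.4; MajdaBertozziCUP2002, §1.6 (1.60)–(1.61); Saffman1992, §13.3 eq. (29)] -/
theorem palasekTowerBreakdown_anyProfile_child_rimCirculation_ge (R : TowerRates) (k : ℕ)
    {l : ℝ} (hl : 0 < l) (hS' : Convex ℝ S') (hv : IsClassicalNSSolutionOn S' 1 0 v q)
    (hω : HasUniformRapidDecayOn S' (fun σ η => PlanarEigenmode.vorticity (v σ) η))
    (hBS : ∀ σ ∈ S', ∀ η, v σ η = biotSavart2D (PlanarEigenmode.vorticity (v σ)) η)
    (hpos : ∀ σ ∈ S', ∀ η, 0 < PlanarEigenmode.vorticity (v σ) η) {L : ℝ} {m : ℕ}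
    (hlog : ∀ σ ∈ S', ∀ η, |Real.log (PlanarEigenmode.vorticity (v σ) η)| ≤ L * (1 + ‖η‖) ^ m)
    (hsc : ∀ σ ∈ S', ∀ η, ‖fderiv ℝ (PlanarEigenmode.vorticity (v σ)) η‖ ≤
      L * (1 + ‖η‖) ^ m * PlanarEigenmode.vorticity (v σ) η)
    (hw : IsSmoothSpaceTimeOn S' w)
    (hmaps : MapsTo (fun t => (exp (l * R.A k * t) - 1) / (l * R.A k)) S S')
    (h0 : (0 : ℝ) ∈ S') {s : ℝ} (hsS : s ∈ S) (hs : 0 ≤ s) (z₀ : ℝ) {r : ℝ} (hr : 0 < r) :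
    (∫ y, PlanarEigenmode.vorticity (v 0) y) * (1 - exp (-(l * R.A k * r ^ 2 / 4))) -
        Real.sqrt (2 * (∫ y, PlanarEigenmode.vorticity (v 0) y) *
          ∫ η, PlanarEigenmode.vorticity (v 0) η *
            Real.log (PlanarEigenmode.vorticity (v 0) η /
              ((∫ y, PlanarEigenmode.vorticity (v 0) y) / (4 * π * (l * R.A k)⁻¹) *
                exp (-(‖η‖ ^ 2 / (4 * (l * R.A k)⁻¹)))))) * exp (-(l * R.A k * s / 2)) ≤
      circulation (velocity (fun _ => l * R.A k)
          (fun t y => exp (l * R.A k * t / 2) •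
            v ((exp (l * R.A k * t) - 1) / (l * R.A k)) (exp (l * R.A k * t / 2) • y))
          (fun t y => exp (-(l * R.A k * t)) •
            w ((exp (l * R.A k * t) - 1) / (l * R.A k)) (exp (l * R.A k * t / 2) • y)) s)
        (circleLoop (z₀ • eZ) r (EuclideanSpace.single 0 1) (EuclideanSpace.single 1 1)) := by
  set c : ℝ := l * R.A k with hc
  have hcpos : 0 < c := mul_pos hl (R.A_pos k)
  set Γ : ℝ := ∫ y, PlanarEigenmode.vorticity (v 0) y with hΓ
  set U : EuclideanSpace ℝ (Fin 3) → EuclideanSpace ℝ (Fin 3) := velocity (fun _ => c)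
    (fun t y => exp (c * t / 2) • v ((exp (c * t) - 1) / c) (exp (c * t / 2) • y))
    (fun t y => exp (-(c * t)) • w ((exp (c * t) - 1) / c) (exp (c * t / 2) • y)) s with hU
  -- smoothness of the Lundgren field's slice
  have hca : ContDiff ℝ ∞ (fun t : ℝ => exp (c * t / 2)) := ((contDiff_const.mul contDiff_id).div_const 2).exp
  have hcτ : ContDiff ℝ ∞ (fun t : ℝ => (exp (c * t) - 1) / c) :=
    (((contDiff_const.mul contDiff_id).exp).sub contDiff_const).div_const c
  have hcd : ContDiff ℝ ∞ (fun t : ℝ => exp (-(c * t))) := (contDiff_const.mul contDiff_id).neg.exp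
  have hV := isSmoothSpaceTimeOn_rescaled (e := fun t => exp (c * t / 2)) hv.smooth_velocity hca hcτ hca hmaps
  have hW := isSmoothSpaceTimeOn_rescaled (e := fun t => exp (-(c * t))) hw hca hcτ hcd hmaps
  have hUs := isSmoothSpaceTimeOn_velocity (γ := fun _ : ℝ => c) contDiff_const hV hW
  have hU1 : ContDiff ℝ 1 U := (hUs.contDiff_slice hsS).of_le (by norm_cast)
  -- the two vorticity slices, read on the coordinate plane
  set ωz : ℝ × ℝ → ℝ := fun p => curl U (embedXY (WithLp.toLp 2 ![p.1, p.2]) + z₀ • eZ) 2 with hωz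
  set ωB : ℝ × ℝ → ℝ := fun p =>
    burgersVorticity c 1 Γ (embedXY (WithLp.toLp 2 ![p.1, p.2]) + z₀ • eZ) with hωB
  have hpt : Continuous fun p : ℝ × ℝ =>
      (embedXY (WithLp.toLp 2 ![p.1, p.2]) + z₀ • eZ : EuclideanSpace ℝ (Fin 3)) := by
    have h1 : Continuous fun p : ℝ × ℝ => (WithLp.toLp 2 ![p.1, p.2] : EuclideanSpace ℝ (Fin 2)) := by
      refine (PiLp.continuous_toLp 2 _).comp ?_
      refine continuous_pi fun i => ?_
      fin_cases i
      · exact continuous_fst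
      · exact continuous_snd
    exact (embedXY.continuous.comp h1).add continuous_const
  have hωzc : Continuous ωz :=
    (PiLp.continuous_apply 2 (fun _ : Fin 3 => ℝ) 2).comp ((continuous_curl hU1).comp hpt)
  have hωBc : Continuous ωB := (contDiff_burgersVorticity c 1 Γ (n := 0)).continuous.comp hpt
  -- Stokes for both fields
  have hSU : circulation U (circleLoop (z₀ • eZ) r (EuclideanSpace.single 0 1) (EuclideanSpace.single 1 1)) =
      ∫ p in {p : ℝ × ℝ | p.1 ^ 2 + p.2 ^ 2 < r ^ 2}, ωz p := rimCirculation_eq_setIntegral_curl hU1 z₀ hr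
  have hSB : Γ * (1 - exp (-(c * r ^ 2 / 4))) = ∫ p in {p : ℝ × ℝ | p.1 ^ 2 + p.2 ^ 2 < r ^ 2}, ωB p := by
    rw [← burgersVortex_rimCirculation c Γ z₀ r,
      rimCirculation_eq_setIntegral_curl (contDiff_burgersVortex c 1 Γ) z₀ hr]
    refine setIntegral_congr_fun (measurableSet_disc r) fun p _ => ?_
    rw [curl_burgersVortex, PiLp.smul_apply, smul_eq_mul]
    simp [hωB]
  -- the whole-plane `L¹` defect, transported to the coordinate plane
  have hL1 := palasekTowerBreakdown_anyProfile_childVorticity_L1_burgers_clock R k hl hS' hv hω hBS hpos hlog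
    hsc hw hmaps h0 hsS hs z₀
  set D₀ : ℝ := Real.sqrt (2 * Γ * ∫ η, PlanarEigenmode.vorticity (v 0) η *
    Real.log (PlanarEigenmode.vorticity (v 0) η /
      (Γ / (4 * π * c⁻¹) * exp (-(‖η‖ ^ 2 / (4 * c⁻¹)))))) * exp (-(c * s / 2)) with hD₀
  have hF : Integrable (fun y : EuclideanSpace ℝ (Fin 2) =>
      |curl U (embedXY y + z₀ • eZ) 2 - burgersVorticity c 1 Γ (embedXY y + z₀ • eZ)|)
      (volume : Measure (EuclideanSpace ℝ (Fin 2))) := by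
    refine (Integrable.sub ?_ (integrable_burgersVorticity_slice hcpos Γ z₀)).abs
    have e : (fun y : EuclideanSpace ℝ (Fin 2) => curl U (embedXY y + z₀ • eZ) 2) = fun y =>
        exp (c * s / 2) ^ 2 * PlanarEigenmode.vorticity (v ((exp (c * s) - 1) / c)) (exp (c * s / 2) • y) := by
      funext y
      rw [hU, curl_lundgren_apply_two (γ := fun _ => c) (a := fun t => exp (c * t / 2))
        (τ := fun t => (exp (c * t) - 1) / c) (d := fun t => exp (-(c * t))) hv.smooth_velocity hw hmaps hsS,
        projXY_add_smul_eZ, projXY_embedXY]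
    rw [e]
    exact ((integrable_planarVorticity hv hω (hmaps hsS)).comp_smul (exp_pos _).ne').const_mul _
  have hFt : Integrable (fun p : ℝ × ℝ => |ωz p - ωB p|) := by
    have := (Literature.Analysis.Calculus.integrable_comp_toLp_fin_two_iff (fun y : EuclideanSpace ℝ (Fin 2) =>
      |curl U (embedXY y + z₀ • eZ) 2 - burgersVorticity c 1 Γ (embedXY y + z₀ • eZ)|)).2 hF
    simpa [hωz, hωB] using this
  have hdef : ∫ p : ℝ × ℝ, |ωz p - ωB p| ≤ D₀ := by
    have e := Literature.Analysis.Calculus.integral_euclidean_eq_integral_prod (fun y : EuclideanSpace ℝ (Fin 2) =>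
      |curl U (embedXY y + z₀ • eZ) 2 - burgersVorticity c 1 Γ (embedXY y + z₀ • eZ)|)
    simp only at e
    rw [← e]
    exact hL1
  -- assemble
  have hIz : IntegrableOn ωz {p : ℝ × ℝ | p.1 ^ 2 + p.2 ^ 2 < r ^ 2} := integrableOn_disc hωzc hr
  have hIB : IntegrableOn ωB {p : ℝ × ℝ | p.1 ^ 2 + p.2 ^ 2 < r ^ 2} := integrableOn_disc hωBc hr
  have hsplit : ∫ p in {p : ℝ × ℝ | p.1 ^ 2 + p.2 ^ 2 < r ^ 2}, ωz p =
      (∫ p in {p : ℝ × ℝ | p.1 ^ 2 + p.2 ^ 2 < r ^ 2}, ωB p) +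
        ∫ p in {p : ℝ × ℝ | p.1 ^ 2 + p.2 ^ 2 < r ^ 2}, (ωz p - ωB p) := by
    rw [integral_sub hIz hIB]; ring
  have habs : |∫ p in {p : ℝ × ℝ | p.1 ^ 2 + p.2 ^ 2 < r ^ 2}, (ωz p - ωB p)| ≤ D₀ := by
    refine (abs_integral_le_integral_abs).trans ((setIntegral_le_integral hFt ?_).trans hdef)
    exact Filter.Eventually.of_forall fun p => abs_nonneg _
  rw [hSU, hsplit, ← hSB]
  have := neg_abs_le (∫ p in {p : ℝ × ℝ | p.1 ^ 2 + p.2 ^ 2 < r ^ 2}, (ωz p - ωB p))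
  linarith

/-- **THE ANY-PROFILE CHILD MEETS THE CORE CLAUSE AFTER THE ENTROPY CLOCK** (same setting; a schedule `Sch`
of the rates, a height `|z₀| ≤ radius`): if at the strain time `s` of the window
`c₁N_{k+1}^{β−2}/4 ≤ Γ(1 − e^{−λA_k/(4N_{k+1}²)}) − (2ΓH₀)^{1/2}e^{−λA_k s/2}`, then the child's velocity field
at time `s` carries a `CoreLedger`-admissible loop of level `k + 1` (the ledger circle in the plane `{x₂ = z₀}`
about the axis, wound four times) with circulation `≥ c₁N_{k+1}^{β−2}`.
[cite: GallayWayne2005, §3.4; Palasek2026ElementaryModel, §3.1] -/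
theorem palasekTowerBreakdown_anyProfile_child_coreClause (R : TowerRates) (Sch : Schedule R) (k : ℕ)
    {l : ℝ} (hl : 0 < l) (hS' : Convex ℝ S') (hv : IsClassicalNSSolutionOn S' 1 0 v q)
    (hω : HasUniformRapidDecayOn S' (fun σ η => PlanarEigenmode.vorticity (v σ) η))
    (hBS : ∀ σ ∈ S', ∀ η, v σ η = biotSavart2D (PlanarEigenmode.vorticity (v σ)) η)
    (hpos : ∀ σ ∈ S', ∀ η, 0 < PlanarEigenmode.vorticity (v σ) η) {L : ℝ} {m : ℕ}
    (hlog : ∀ σ ∈ S', ∀ η, |Real.log (PlanarEigenmode.vorticity (v σ) η)| ≤ L * (1 + ‖η‖) ^ m)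
    (hsc : ∀ σ ∈ S', ∀ η, ‖fderiv ℝ (PlanarEigenmode.vorticity (v σ)) η‖ ≤
      L * (1 + ‖η‖) ^ m * PlanarEigenmode.vorticity (v σ) η)
    (hw : IsSmoothSpaceTimeOn S' w)
    (hmaps : MapsTo (fun t => (exp (l * R.A k * t) - 1) / (l * R.A k)) S S')
    (h0 : (0 : ℝ) ∈ S') {s : ℝ} (hsS : s ∈ S) (hs : 0 ≤ s) {z₀ : ℝ} (hz₀ : |z₀| ≤ Sch.radius)
    (hclock : Sch.c₁ * R.N (k + 1) ^ (R.β - 2) / 4 ≤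
      (∫ y, PlanarEigenmode.vorticity (v 0) y) * (1 - exp (-(l * R.A k / (4 * R.N (k + 1) ^ 2)))) -
        Real.sqrt (2 * (∫ y, PlanarEigenmode.vorticity (v 0) y) *
          ∫ η, PlanarEigenmode.vorticity (v 0) η *
            Real.log (PlanarEigenmode.vorticity (v 0) η /
              ((∫ y, PlanarEigenmode.vorticity (v 0) y) / (4 * π * (l * R.A k)⁻¹) *
                exp (-(‖η‖ ^ 2 / (4 * (l * R.A k)⁻¹)))))) * exp (-(l * R.A k * s / 2))) :
    ∃ (x' : EuclideanSpace ℝ (Fin 3)) (γ : ℝ → EuclideanSpace ℝ (Fin 3)),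
      ‖x'‖ ≤ Sch.radius ∧ ContDiff ℝ 1 γ ∧ γ 0 = γ 1 ∧
      (∀ σ ∈ Icc (0 : ℝ) 1, γ σ ∈ Metric.closedBall x' (1 / R.N (k + 1))) ∧
      (∀ σ ∈ Icc (0 : ℝ) 1, ‖deriv γ σ‖ ≤ 8 * π / R.N (k + 1)) ∧
      Sch.c₁ * R.N (k + 1) ^ (R.β - 2) ≤
        circulation (velocity (fun _ => l * R.A k)
          (fun t y => exp (l * R.A k * t / 2) •
            v ((exp (l * R.A k * t) - 1) / (l * R.A k)) (exp (l * R.A k * t / 2) • y))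
          (fun t y => exp (-(l * R.A k * t)) •
            w ((exp (l * R.A k * t) - 1) / (l * R.A k)) (exp (l * R.A k * t / 2) • y)) s) γ := by
  set c : ℝ := l * R.A k with hc
  have hcpos : 0 < c := mul_pos hl (R.A_pos k)
  have hN1 := R.N_pos (k + 1)
  -- smoothness of the slice (as in `_rimCirculation_ge`)
  have hca : ContDiff ℝ ∞ (fun t : ℝ => exp (c * t / 2)) := ((contDiff_const.mul contDiff_id).div_const 2).exp
  have hcτ : ContDiff ℝ ∞ (fun t : ℝ => (exp (c * t) - 1) / c) :=
    (((contDiff_const.mul contDiff_id).exp).sub contDiff_const).div_const c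
  have hcd : ContDiff ℝ ∞ (fun t : ℝ => exp (-(c * t))) := (contDiff_const.mul contDiff_id).neg.exp
  have hV := isSmoothSpaceTimeOn_rescaled (e := fun t => exp (c * t / 2)) hv.smooth_velocity hca hcτ hca hmaps
  have hW := isSmoothSpaceTimeOn_rescaled (e := fun t => exp (-(c * t))) hw hca hcτ hcd hmaps
  have hUs := isSmoothSpaceTimeOn_velocity (γ := fun _ : ℝ => c) contDiff_const hV hW
  have hU1 := (hUs.contDiff_slice hsS).of_le (show (1 : WithTop ℕ∞) ≤ ∞ by norm_cast)
  have hzn : ‖(z₀ • eZ : EuclideanSpace ℝ (Fin 3))‖ ≤ Sch.radius := by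
    rw [norm_smul, Real.norm_eq_abs]; simp [eZ]; exact hz₀
  refine coreClause_of_rimCirculation Sch (k + 1) hU1 (x := z₀ • eZ) hzn norm_eX norm_eY inner_eX_eY ?_
  have hge := palasekTowerBreakdown_anyProfile_child_rimCirculation_ge R k hl hS' hv hω hBS hpos hlog hsc hw
    hmaps h0 hsS hs z₀ (r := 1 / R.N (k + 1)) (by positivity)
  have hx : l * R.A k * (1 / R.N (k + 1)) ^ 2 / 4 = l * R.A k / (4 * R.N (k + 1) ^ 2) := by
    field_simp
  rw [hx] at hge
  exact hclock.trans hge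

/-! ### The core clock as a number of strain times (wide rates, `λ = 1`) -/

namespace CoreClock

/-- `e^{−x} ≤ 0.01832` for `x ≥ 4` (`e > 2.71828`, `2.71828⁴ > 54.58`). [folklore] -/
theorem exp_neg_le_of_four_le {x : ℝ} (hx : 4 ≤ x) : exp (-x) ≤ 0.01832 := by
  have h1 : exp (-x) ≤ exp (-4) := exp_le_exp.2 (by linarith)
  have he : (2.7182818283 : ℝ) < exp 1 := Real.exp_one_gt_d9
  have h4 : exp 4 = exp 1 ^ 4 := by rw [← Real.exp_nat_mul]; norm_num
  have hpow : (2.7182818283 : ℝ) ^ 4 < exp 1 ^ 4 := by gcongr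
  have hinv : exp (-4) ≤ 0.01832 := by
    rw [Real.exp_neg, inv_le_comm₀ (exp_pos _) (by norm_num), h4]
    nlinarith [hpow]
  exact h1.trans hinv

/-- `√2 < 1.4143`. [folklore] -/
theorem sqrt_two_lt' : Real.sqrt 2 < 1.4143 := by
  rw [show (1.4143 : ℝ) = Real.sqrt (1.4143 ^ 2) by rw [Real.sqrt_sq (by norm_num)]]
  exact Real.sqrt_lt_sqrt (by norm_num) (by norm_num)

end CoreClock

/-- **THE CORE CLOCK AS A NUMBER** (wide rates, `λ = 1`, any schedule, any level `k ≥ 2`; the any-profile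
setting of `palasekTowerBreakdown_anyProfile_child_coreClause`): if the hand-over entropy is at most the
circulation (`H₀ ≤ Γ`), the circulation is on the core-ledger scale with **`Γ ≥ 0.86·c₁·N_{k+1}^{β−2}`**, and
**`A_k s ≥ 8`** (eight strain times into the window), then the child's flow at strain time `s` meets the
level-`(k+1)` core clause on every cross-section `{x₂ = z₀}`, `|z₀| ≤ radius`
(`x_k ≥ x_2 > 1.95` ⇒ `1 − e^{−x_k/4} ≥ 0.3277`; `(2ΓH₀)^{1/2}e^{−A_k s/2} ≤ 1.4143·0.01832·Γ`;
`4·0.86·(0.3277 − 0.0260) > 1`). Compare the Burgers child's `C ≥ 0.77·c₁` (`…_coreClause_stokes_wide`).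
MODEL statement; not about any registered flow. [cite: GallayWayne2005, §3.4; Palasek2026ElementaryModel, §3.1] -/
theorem palasekTowerBreakdown_anyProfile_child_coreClause_wide (Sch : Schedule TowerRates.wide) {k : ℕ}
    (hk : 2 ≤ k) (hS' : Convex ℝ S') (hv : IsClassicalNSSolutionOn S' 1 0 v q)
    (hω : HasUniformRapidDecayOn S' (fun σ η => PlanarEigenmode.vorticity (v σ) η))
    (hBS : ∀ σ ∈ S', ∀ η, v σ η = biotSavart2D (PlanarEigenmode.vorticity (v σ)) η)
    (hpos : ∀ σ ∈ S', ∀ η, 0 < PlanarEigenmode.vorticity (v σ) η) {L : ℝ} {m : ℕ}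
    (hlog : ∀ σ ∈ S', ∀ η, |Real.log (PlanarEigenmode.vorticity (v σ) η)| ≤ L * (1 + ‖η‖) ^ m)
    (hsc : ∀ σ ∈ S', ∀ η, ‖fderiv ℝ (PlanarEigenmode.vorticity (v σ)) η‖ ≤
      L * (1 + ‖η‖) ^ m * PlanarEigenmode.vorticity (v σ) η)
    (hw : IsSmoothSpaceTimeOn S' w)
    (hmaps : MapsTo (fun t => (exp (1 * TowerRates.wide.A k * t) - 1) / (1 * TowerRates.wide.A k)) S S')
    (h0 : (0 : ℝ) ∈ S') {s : ℝ} (hsS : s ∈ S) (hs8 : 8 ≤ TowerRates.wide.A k * s) {z₀ : ℝ}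
    (hz₀ : |z₀| ≤ Sch.radius)
    (hH : (∫ η, PlanarEigenmode.vorticity (v 0) η *
        Real.log (PlanarEigenmode.vorticity (v 0) η /
          ((∫ y, PlanarEigenmode.vorticity (v 0) y) / (4 * π * (1 * TowerRates.wide.A k)⁻¹) *
            exp (-(‖η‖ ^ 2 / (4 * (1 * TowerRates.wide.A k)⁻¹)))))) ≤ ∫ y, PlanarEigenmode.vorticity (v 0) y)
    (hC : 0.86 * Sch.c₁ * TowerRates.wide.N (k + 1) ^ (TowerRates.wide.β - 2) ≤
      ∫ y, PlanarEigenmode.vorticity (v 0) y) :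
    ∃ (x' : EuclideanSpace ℝ (Fin 3)) (γ : ℝ → EuclideanSpace ℝ (Fin 3)),
      ‖x'‖ ≤ Sch.radius ∧ ContDiff ℝ 1 γ ∧ γ 0 = γ 1 ∧
      (∀ σ ∈ Icc (0 : ℝ) 1, γ σ ∈ Metric.closedBall x' (1 / TowerRates.wide.N (k + 1))) ∧
      (∀ σ ∈ Icc (0 : ℝ) 1, ‖deriv γ σ‖ ≤ 8 * π / TowerRates.wide.N (k + 1)) ∧
      Sch.c₁ * TowerRates.wide.N (k + 1) ^ (TowerRates.wide.β - 2) ≤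
        circulation (velocity (fun _ => 1 * TowerRates.wide.A k)
          (fun t y => exp (1 * TowerRates.wide.A k * t / 2) •
            v ((exp (1 * TowerRates.wide.A k * t) - 1) / (1 * TowerRates.wide.A k))
              (exp (1 * TowerRates.wide.A k * t / 2) • y))
          (fun t y => exp (-(1 * TowerRates.wide.A k * t)) •
            w ((exp (1 * TowerRates.wide.A k * t) - 1) / (1 * TowerRates.wide.A k))
              (exp (1 * TowerRates.wide.A k * t / 2) • y)) s) γ := by
  have hA := TowerRates.wide.A_pos k
  have hs : 0 ≤ s := by nlinarith
  set Γ : ℝ := ∫ y, PlanarEigenmode.vorticity (v 0) y with hΓ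
  have hΓ0 : 0 ≤ Γ := integral_nonneg fun η => (hpos 0 h0 η).le
  set H₀ : ℝ := ∫ η, PlanarEigenmode.vorticity (v 0) η *
    Real.log (PlanarEigenmode.vorticity (v 0) η /
      (Γ / (4 * π * (1 * TowerRates.wide.A k)⁻¹) *
        exp (-(‖η‖ ^ 2 / (4 * (1 * TowerRates.wide.A k)⁻¹))))) with hH₀
  have hNβ : 0 < TowerRates.wide.N (k + 1) ^ (TowerRates.wide.β - 2) :=
    Real.rpow_pos_of_pos (TowerRates.wide.N_pos _) _
  refine palasekTowerBreakdown_anyProfile_child_coreClause TowerRates.wide Sch k one_pos hS' hv hω hBS hpos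
    hlog hsc hw hmaps h0 hsS hs hz₀ ?_
  -- (i) `1 − e^{−x_k/4} ≥ 0.3277`, `x_k = N_k^{β−2b} ≥ x_2 > 1.95`
  set x : ℝ := 1 * TowerRates.wide.N k ^ (TowerRates.wide.β - 2 * TowerRates.wide.b) with hxdef
  have hx : 1 * TowerRates.wide.A k / (4 * TowerRates.wide.N (k + 1) ^ 2) = x / 4 := by
    rw [hxdef, ← palasekTowerBreakdown_coreRatio_eq]; ring
  obtain ⟨hlo, -⟩ := wide_coreRatio_two_bounds
  have hmono := palasekTowerBreakdown_coreRatio_mono TowerRates.wide hk zero_le_one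
  have hx2 : 1.95 < x := by rw [hxdef]; linarith
  have hx0 : 0 < 1 + x / 4 := by linarith
  have he : exp (-(x / 4)) ≤ (1 + x / 4)⁻¹ := by
    rw [Real.exp_neg, inv_le_inv₀ (exp_pos _) hx0]
    linarith [add_one_le_exp (x / 4)]
  have hinv : (1 + x / 4)⁻¹ ≤ 0.6723 := by
    rw [inv_le_comm₀ hx0 (by norm_num)]
    norm_num; linarith
  have h1 : 0.3277 ≤ 1 - exp (-(1 * TowerRates.wide.A k / (4 * TowerRates.wide.N (k + 1) ^ 2))) := by
    rw [hx]; linarith [he.trans hinv]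
  -- (ii) the clock defect `(2ΓH₀)^{1/2} e^{−A_k s/2} ≤ 1.4143 · Γ · 0.01832`
  have hsq : Real.sqrt (2 * Γ * H₀) ≤ 1.4143 * Γ := by
    have h2 : 2 * Γ * H₀ ≤ (Real.sqrt 2 * Γ) ^ 2 := by
      rw [mul_pow, Real.sq_sqrt (by norm_num : (0 : ℝ) ≤ 2)]
      nlinarith [mul_le_mul_of_nonneg_left hH hΓ0]
    calc Real.sqrt (2 * Γ * H₀) ≤ Real.sqrt ((Real.sqrt 2 * Γ) ^ 2) := Real.sqrt_le_sqrt h2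
      _ = Real.sqrt 2 * Γ := Real.sqrt_sq (by positivity)
      _ ≤ 1.4143 * Γ := mul_le_mul_of_nonneg_right CoreClock.sqrt_two_lt'.le hΓ0
  have hexp : exp (-(1 * TowerRates.wide.A k * s / 2)) ≤ 0.01832 :=
    CoreClock.exp_neg_le_of_four_le (by linarith)
  have hdef : Real.sqrt (2 * Γ * H₀) * exp (-(1 * TowerRates.wide.A k * s / 2)) ≤ 1.4143 * Γ * 0.01832 :=
    mul_le_mul hsq hexp (exp_pos _).le (by positivity)
  -- (iii) assemble
  have hc₁ := Sch.c₁_pos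
  have hmain : Sch.c₁ * TowerRates.wide.N (k + 1) ^ (TowerRates.wide.β - 2) / 4 ≤
      Γ * 0.3277 - 1.4143 * Γ * 0.01832 := by
    nlinarith [hC, hNβ]
  refine hmain.trans ?_
  nlinarith [mul_le_mul_of_nonneg_left h1 hΓ0, hdef]

end Summit.NavierStokesRegularity.FluidComputer.PalasekTowerClayBridge
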